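import Literature.Combinatorics.StablePolynomials.Basic
import Literature.Combinatorics.StablePolynomials.BasicProofs
import Literature.Combinatorics.StablePolynomials.KernelForm
import Literature.Combinatorics.StablePolynomials.Limits
import HarnessLib

/-!
# The negative lattice condition for real stable multi-affine polynomials

Topic `Literature/Combinatorics/StablePolynomials`. For a multi-affine polynomial
`Q(z) = Σ_S a(S) z^S` with REAL coefficients and no zero in the open upper half-space `H^σ`
(upper-half-plane stable; no sign or normalisation assumption on the coefficients), the
coefficient family satisfies the **pairwise negative lattice condition with constant one**:

  `a(T) · a(T ∪ {x,y}) ≤ a(T ∪ {x}) · a(T ∪ {y})`   for all `T ⊆ σ` and all `x ≠ y ∉ T`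

(`multiAffine_negLatticeCondition`). For the generating polynomial of a strongly Rayleigh measure
this is the negative lattice condition of Borcea–Brändén–Liggett, *Negative dependence and the
geometry of polynomials*, J. Amer. Math. Soc. 22 (2009), §2.1 (definitions: Rayleigh, strongly
Rayleigh, NLC) and §4.1 (strongly Rayleigh ⇒ Rayleigh ⇒ pairwise NLC); it is also the direction
"stable ⇒ `Δ_xy ≥ 0`" of Brändén's Rayleigh criterion (Brändén 2007, Thm. 5.6), evaluated at the
origin for the mixed derivative `∂^T Q`.

## Contents and proof

* `pderiv_multiAffine`, `foldr_pderiv_multiAffine` — derivatives of the coefficient form: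
  `∂ᵢ Σ_S a(S) z^S = Σ_{S ∌ i} a(S ∪ i) z^S`, and `∂^T Q = Σ_{S ∩ T = ∅} a(S ∪ T) z^S` along a
  duplicate-free list (Mathlib `MvPolynomial.pderiv_monomial` on the tree's `prod_X_eq_monomial`).
* `multiAffine_twoByTwo_nlc` — the two-by-two case in function form: if `Σ_S b(S) z^S` (real `b`)
  is identically zero or zero-free on `H^σ`, then `b(∅) b({x,y}) ≤ b({x}) b({y})`. Direct
  perturbation argument: with `A = b(∅), B = b{x}, C = b{y}, D = b{x,y}` and `AD - BC > 0`, the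
  real Möbius map `u ↦ -(A + Bu)/(C + Du)` sends `H` into `H`, so the bivariate part
  `A + Bu + Cw + Duw` vanishes at `(i, w₀)`, `Im w₀ = (AD - BC)/(C² + D²) > 0`; putting every other
  variable at `iε`, the polynomial is affine in `w`, `= P(ε) + w R(ε)` with `P, R` continuous,
  `P(0) = A + Bi`, `R(0) = C + Di ≠ 0`, and the root `w(ε) = -P(ε)/R(ε) → w₀` stays in `H` for
  small `ε > 0` — a zero in `H^σ`, contradiction.
* `multiAffine_negLatticeCondition` — the general case: `∂^T Q` is `0` or stable
  (`IsUpperHalfPlaneStable.foldr_pderiv`), and the two-by-two lemma reads off the four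
  coefficients `a(T), a(T ∪ x), a(T ∪ y), a(T ∪ {x,y})`.

Written for the sector-energy convexity argument of crux `BECStronglyRayleigh.InsertionFieldDelocalisation`
(line `mobile-trap-dirichlet-eigenfunction`, stub `stub_convexity`: NLC of `e^{-τH}𝟙` ⇒
`2E(N) ≤ E(N+1) + E(N-1)`), but stated in full generality. What is NOT here: the converse
direction of Brändén's criterion (the named fact `Branden2007_multiAffine_rayleighDiff_nonneg_iff_realStable`
of `Basic.lean`), the Rayleigh inequality at arbitrary real points, and anything about measures.

## Mathlib / tree search

REUSED: `multiAffine`, `isUpperHalfPlaneStable_multiAffine_iff`, `multiAffine_eq_zero_iff`,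
`prod_X_eq_monomial`, `sum_single_one_apply`, `IsUpperHalfPlaneStable.foldr_pderiv` (tree);
Mathlib `MvPolynomial.pderiv_monomial`, `ContinuousAt.div`, `Metric.eventually_nhds_iff`,
`Complex.div_im`. Mathlib has no stable-polynomial theory (searched `Rayleigh`, `negative lattice`,
`IsStable` polynomial).
-/

noncomputable section

namespace Literature.Combinatorics.StablePolynomials

open MvPolynomial Finset Filter Topology
open scoped BigOperators

variable {σ : Type*} [Fintype σ] [DecidableEq σ]

/-- `∂ᵢ (Σ_S a(S) z^S) = Σ_{S ∌ i} a(S ∪ {i}) z^S`: the partial derivative of a multi-affine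
polynomial in coefficient form is the multi-affine polynomial of the shifted coefficients.
[folklore] -/
theorem pderiv_multiAffine (a : Finset σ → ℂ) (i : σ) :
    pderiv i (multiAffine a) = multiAffine (fun S => if i ∈ S then 0 else a (insert i S)) := by
  classical
  have hind : ∀ S : Finset σ, (∑ j ∈ S, Finsupp.single j 1 : σ →₀ ℕ) i = if i ∈ S then 1 else 0 :=
    fun S => sum_single_one_apply S i
  simp only [multiAffine, prod_X_eq_monomial, C_mul_monomial, mul_one, map_sum, pderiv_monomial,
    hind]
  rw [← Finset.sum_filter_add_sum_filter_not univ (fun S => i ∈ S)]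
  have h2 : ∑ S ∈ univ.filter (fun S => ¬ i ∈ S),
      monomial (∑ j ∈ S, Finsupp.single j 1 - Finsupp.single i 1)
        (a S * ((if i ∈ S then 1 else 0 : ℕ) : ℂ)) = 0 := by
    refine Finset.sum_eq_zero fun S hS => ?_
    rw [Finset.mem_filter] at hS
    simp [hS.2]
  rw [h2, add_zero]
  symm
  rw [← Finset.sum_filter_add_sum_filter_not univ (fun S => i ∈ S)]
  have h3 : ∑ S ∈ univ.filter (fun S => i ∈ S),
      monomial (∑ j ∈ S, Finsupp.single j 1) (if i ∈ S then (0 : ℂ) else a (insert i S)) = 0 := by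
    refine Finset.sum_eq_zero fun S hS => ?_
    rw [Finset.mem_filter] at hS
    simp [hS.2]
  rw [h3, zero_add]
  refine Finset.sum_nbij' (fun S => insert i S) (fun S => S.erase i) ?_ ?_ ?_ ?_ ?_
  · intro S hS
    simp only [mem_filter, mem_univ, true_and] at hS ⊢
    exact mem_insert_self i S
  · intro S hS
    simp only [mem_filter, mem_univ, true_and] at hS ⊢
    exact Finset.notMem_erase i S
  · intro S hS
    simp only [mem_filter, mem_univ, true_and] at hS
    exact erase_insert hS
  · intro S hS
    simp only [mem_filter, mem_univ, true_and] at hS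
    exact insert_erase hS
  · intro S hS
    simp only [mem_filter, mem_univ, true_and] at hS
    rw [if_neg hS, if_pos (mem_insert_self i S), Finset.sum_insert hS, add_tsub_cancel_left]
    push_cast
    rw [mul_one]

/-- Mixed partial derivatives of the coefficient form along a duplicate-free list `l` of
variables: `∂^l (Σ_S a(S) z^S) = Σ_{S ∩ l = ∅} a(S ∪ l) z^S`. [folklore] -/
theorem foldr_pderiv_multiAffine (a : Finset σ → ℂ) (l : List σ) (hl : l.Nodup) :
    l.foldr (fun i q => pderiv i q) (multiAffine a) =
      multiAffine (fun S => if Disjoint l.toFinset S then a (S ∪ l.toFinset) else 0) := by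
  classical
  induction l with
  | nil =>
    simp only [List.foldr_nil, List.toFinset_nil, Finset.disjoint_empty_left, if_true,
      Finset.union_empty]
  | cons i l ih =>
    rw [List.foldr_cons, ih (List.Nodup.of_cons hl), pderiv_multiAffine]
    have hi : i ∉ l.toFinset := fun h => (List.nodup_cons.1 hl).1 (List.mem_toFinset.1 h)
    congr 1
    funext S
    rw [List.toFinset_cons]
    by_cases hiS : i ∈ S
    · rw [if_pos hiS, if_neg]
      exact fun h => Finset.disjoint_left.1 h (Finset.mem_insert_self i _) hiS
    · rw [if_neg hiS]
      by_cases hd : Disjoint l.toFinset S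
      · have hd' : Disjoint l.toFinset (insert i S) :=
          Finset.disjoint_insert_right.2 ⟨hi, hd⟩
        have hd'' : Disjoint (insert i l.toFinset) S :=
          Finset.disjoint_insert_left.2 ⟨hiS, hd⟩
        rw [if_pos hd', if_pos hd'', Finset.insert_union, Finset.union_insert]
      · have hd' : ¬ Disjoint l.toFinset (insert i S) :=
          fun h => hd (Finset.disjoint_of_subset_right (Finset.subset_insert i S) h)
        have hd'' : ¬ Disjoint (insert i l.toFinset) S :=
          fun h => hd (Finset.disjoint_of_subset_left (Finset.subset_insert i _) h)
        rw [if_neg hd', if_neg hd'']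

/-- **The two-by-two negative lattice condition.** If the multi-affine function
`z ↦ Σ_S b(S) ∏_{i∈S} zᵢ` with real coefficients is identically zero or has no zero in `H^σ`, then
`b(∅) · b({x,y}) ≤ b({x}) · b({y})` for `x ≠ y` (real stability of the bivariate part
`A + Bu + Cw + Duw` forces `BC ≥ AD`: otherwise the real Möbius map `u ↦ -(A+Bu)/(C+Du)` sends `H`
into `H` and, with all other variables at `iε`, `ε ↓ 0`, produces a zero in `H^σ`).
[cite: BorceaBrandenLiggett2007, §2.1 and §4.1] -/
theorem multiAffine_twoByTwo_nlc (b : Finset σ → ℝ) {x y : σ} (hxy : x ≠ y)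
    (hb : (∀ S, b S = 0) ∨
      ∀ z : σ → ℂ, (∀ i, 0 < (z i).im) → (∑ S : Finset σ, (b S : ℂ) * ∏ i ∈ S, z i) ≠ 0) :
    b ∅ * b {x, y} ≤ b {x} * b {y} := by
  classical
  rcases hb with hb | hb
  · simp [hb]
  by_contra hlt
  push Not at hlt
  set A := b ∅ with hA
  set B := b {x} with hB
  set C := b {y} with hC
  set D := b {x, y} with hD
  have hdet : 0 < A * D - B * C := by linarith
  -- the base point (all variables except `x`, `y` at `iε`; `x` at `i`; the value at `y` is unused)
  let z₀ : ℝ → σ → ℂ := fun ε j => if j = x then Complex.I else (ε : ℂ) * Complex.I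
  -- the affine decomposition `F(update (z₀ ε) y w) = P ε + w * R ε`
  let P : ℝ → ℂ := fun ε => ∑ S ∈ univ.filter (fun S => y ∉ S), (b S : ℂ) * ∏ i ∈ S, z₀ ε i
  let R : ℝ → ℂ := fun ε => ∑ S ∈ univ.filter (fun S => y ∈ S), (b S : ℂ) * ∏ i ∈ S.erase y, z₀ ε i
  have hF : ∀ (ε : ℝ) (w : ℂ),
      (∑ S : Finset σ, (b S : ℂ) * ∏ i ∈ S, Function.update (z₀ ε) y w i) = P ε + w * R ε := by
    intro ε w
    rw [← Finset.sum_filter_add_sum_filter_not univ (fun S => y ∉ S)]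
    congr 1
    · refine Finset.sum_congr rfl fun S hS => ?_
      rw [Finset.mem_filter] at hS
      rw [Finset.prod_congr rfl fun i hi => Function.update_of_ne (ne_of_mem_of_not_mem hi hS.2) w (z₀ ε)]
    · rw [Finset.mul_sum]
      have hf : univ.filter (fun S : Finset σ => ¬ y ∉ S) = univ.filter (fun S => y ∈ S) := by
        ext S; simp
      rw [hf]
      refine Finset.sum_congr rfl fun S hS => ?_
      rw [Finset.mem_filter] at hS
      rw [← Finset.mul_prod_erase S _ hS.2, Function.update_self,
        Finset.prod_congr rfl fun i hi =>
          Function.update_of_ne (Finset.ne_of_mem_erase hi) w (z₀ ε)]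
      ring
  -- values at `ε = 0`
  have hz0 : ∀ j, j ≠ x → z₀ 0 j = 0 := fun j hj => by
    simp only [z₀, if_neg hj, Complex.ofReal_zero, zero_mul]
  have hprod0 : ∀ S : Finset σ, (∃ j ∈ S, j ≠ x) → ∏ i ∈ S, z₀ 0 i = 0 := by
    rintro S ⟨j, hj, hjx⟩
    exact Finset.prod_eq_zero hj (hz0 j hjx)
  have hP0 : P 0 = (A : ℂ) + (B : ℂ) * Complex.I := by
    have h1 : P 0 = ∑ S ∈ ({∅, {x}} : Finset (Finset σ)), (b S : ℂ) * ∏ i ∈ S, z₀ 0 i := by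
      symm
      refine Finset.sum_subset ?_ ?_
      · intro S hS
        simp only [Finset.mem_insert, Finset.mem_singleton] at hS
        rcases hS with rfl | rfl <;> simp [hxy.symm]
      · intro S hS hS'
        simp only [Finset.mem_insert, Finset.mem_singleton, not_or] at hS'
        rw [Finset.mem_filter] at hS
        have : ∃ j ∈ S, j ≠ x := by
          by_contra h
          push Not at h
          have hsub : S ⊆ {x} := fun j hj => Finset.mem_singleton.2 (h j hj)
          rcases Finset.subset_singleton_iff.1 hsub with h' | h'
          · exact hS'.1 h'
          · exact hS'.2 h'
        rw [hprod0 S this, mul_zero]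
    rw [h1, Finset.sum_pair]
    · simp [z₀, hA, hB]
    · exact (Finset.singleton_ne_empty x).symm
  have hR0 : R 0 = (C : ℂ) + (D : ℂ) * Complex.I := by
    have h1 : R 0 = ∑ S ∈ ({{y}, {x, y}} : Finset (Finset σ)), (b S : ℂ) * ∏ i ∈ S.erase y, z₀ 0 i := by
      symm
      refine Finset.sum_subset ?_ ?_
      · intro S hS
        simp only [Finset.mem_insert, Finset.mem_singleton] at hS
        rcases hS with rfl | rfl <;> simp
      · intro S hS hS'
        simp only [Finset.mem_insert, Finset.mem_singleton, not_or] at hS'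
        rw [Finset.mem_filter] at hS
        have : ∃ j ∈ S.erase y, j ≠ x := by
          by_contra h
          push Not at h
          have hsub : S.erase y ⊆ {x} := fun j hj => Finset.mem_singleton.2 (h j hj)
          rcases Finset.subset_singleton_iff.1 hsub with h' | h'
          · apply hS'.1
            rw [← Finset.insert_erase hS.2, h']
            rfl
          · apply hS'.2
            rw [← Finset.insert_erase hS.2, h', Finset.pair_comm]
        rw [hprod0 _ this, mul_zero]
    rw [h1, Finset.sum_pair]
    · have hex : ({x, y} : Finset σ).erase y = {x} := by
        ext j
        simp only [Finset.mem_erase, Finset.mem_insert, Finset.mem_singleton]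
        constructor
        · rintro ⟨h1, h2 | h2⟩
          · exact h2
          · exact absurd h2 h1
        · intro h
          subst h
          exact ⟨hxy, Or.inl rfl⟩
      simp [z₀, hC, hD, hex]
    · intro h
      have : x ∈ ({y} : Finset σ) := by rw [h]; simp
      exact hxy (Finset.mem_singleton.1 this)
  -- `C + Di ≠ 0`
  have hCD : (C : ℂ) + (D : ℂ) * Complex.I ≠ 0 := by
    intro h
    have hre := congrArg Complex.re h
    have him := congrArg Complex.im h
    simp at hre him
    rw [hre, him] at hdet
    linarith
  have hR0ne : R 0 ≠ 0 := by rwa [hR0]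
  -- continuity of `P`, `R` and of the root `w ε = -P ε / R ε` at `ε = 0`
  have hcontz : ∀ j, Continuous fun ε : ℝ => z₀ ε j := by
    intro j
    by_cases hj : j = x
    · simp only [z₀, if_pos hj]
      exact continuous_const
    · simp only [z₀, if_neg hj]
      exact Complex.continuous_ofReal.mul continuous_const
  have hPc : Continuous P :=
    continuous_finsetSum _ fun S _ => continuous_const.mul (continuous_finsetProd _ fun i _ => hcontz i)
  have hRc : Continuous R :=
    continuous_finsetSum _ fun S _ => continuous_const.mul (continuous_finsetProd _ fun i _ => hcontz i)
  let w : ℝ → ℂ := fun ε => -P ε / R ε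
  have hwc : ContinuousAt w 0 := (hPc.neg.continuousAt).div hRc.continuousAt hR0ne
  -- `Im w(0) = (AD - BC)/(C² + D²) > 0`
  have hw0 : 0 < (w 0).im := by
    have hformula : (w 0).im = (A * D - B * C) / (C ^ 2 + D ^ 2) := by
      show (-P 0 / R 0).im = _
      rw [hP0, hR0, Complex.div_im]
      simp [Complex.normSq_apply]
      ring
    have hden : 0 < C ^ 2 + D ^ 2 := by
      by_contra hle
      push Not at hle
      have hC0 : C = 0 := by nlinarith [sq_nonneg C, sq_nonneg D]
      have hD0 : D = 0 := by nlinarith [sq_nonneg C, sq_nonneg D]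
      apply hCD
      rw [hC0, hD0]
      simp
    rw [hformula]
    exact div_pos hdet hden
  -- for small `ε > 0` the root stays in `H`
  have hev : ∀ᶠ ε in 𝓝 (0 : ℝ), 0 < (w ε).im :=
    (Complex.continuous_im.continuousAt.comp hwc).eventually (lt_mem_nhds hw0)
  obtain ⟨δ, hδ, hball⟩ := Metric.eventually_nhds_iff.1 hev
  have hε : 0 < δ / 2 := by linarith
  have himw : 0 < (w (δ / 2)).im := by
    apply hball
    rw [Real.dist_eq, sub_zero, abs_of_pos hε]
    linarith
  have hRne : R (δ / 2) ≠ 0 := by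
    intro h
    have : w (δ / 2) = 0 := by simp only [w, h, div_zero]
    rw [this] at himw
    simp at himw
  -- the zero in `H^σ`
  have hzero : (∑ S : Finset σ, (b S : ℂ) * ∏ i ∈ S, Function.update (z₀ (δ / 2)) y (w (δ / 2)) i) = 0 := by
    rw [hF]
    simp only [w]
    field_simp
    ring
  have hH : ∀ i, 0 < (Function.update (z₀ (δ / 2)) y (w (δ / 2)) i).im := by
    intro i
    by_cases hiy : i = y
    · subst hiy
      rw [Function.update_self]
      exact himw
    · rw [Function.update_of_ne hiy]
      by_cases hix : i = x
      · simp [z₀, hix]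
      · simp [z₀, hix, hε]
  exact hb _ hH hzero

/-- **Negative lattice condition for real stable multi-affine polynomials** (constant one):
if `Σ_S a(S) z^S` has real coefficients and no zero in `H^σ`, then for every `T ⊆ σ` and all
`x ≠ y` outside `T`, `a(T) · a(T ∪ {x,y}) ≤ a(T ∪ {x}) · a(T ∪ {y})`. In the language of
Borcea–Brändén–Liggett: a strongly Rayleigh (not necessarily probability, not necessarily
normalised) coefficient family satisfies the pairwise negative lattice condition; equivalently the
direction "stable ⇒ `Δ_xy(∂^T Q)(0) ≥ 0`" of Brändén's Rayleigh criterion. Proof: `∂^T` of the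
polynomial is `0` or stable (`IsUpperHalfPlaneStable.foldr_pderiv`) with coefficients
`a(S ∪ T)` on `S ∩ T = ∅` (`foldr_pderiv_multiAffine`), and `multiAffine_twoByTwo_nlc` applies.
[cite: BorceaBrandenLiggett2007, §2.1 and §4.1] -/
theorem multiAffine_negLatticeCondition (a : Finset σ → ℝ)
    (ha : ∀ z : σ → ℂ, (∀ i, 0 < (z i).im) → (∑ S : Finset σ, (a S : ℂ) * ∏ i ∈ S, z i) ≠ 0)
    (T : Finset σ) {x y : σ} (hx : x ∉ T) (hy : y ∉ T) (hxy : x ≠ y) :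
    a T * a (insert x (insert y T)) ≤ a (insert x T) * a (insert y T) := by
  classical
  -- the stable polynomial and its mixed derivative along `T`
  have hQ : IsUpperHalfPlaneStable (multiAffine fun S => (a S : ℂ)) :=
    (isUpperHalfPlaneStable_multiAffine_iff _).2 ha
  set l := T.toList with hl
  have hln : l.Nodup := Finset.nodup_toList T
  have hlT : l.toFinset = T := Finset.toList_toFinset T
  have hder := hQ.foldr_pderiv l
  rw [foldr_pderiv_multiAffine _ l hln, hlT] at hder
  -- its coefficients, as a real family
  let b : Finset σ → ℝ := fun S => if Disjoint T S then a (S ∪ T) else 0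
  have hb : (fun S => if Disjoint T S then ((a (S ∪ T) : ℝ) : ℂ) else 0) = fun S => ((b S : ℝ) : ℂ) := by
    funext S
    by_cases h : Disjoint T S <;> simp [b, h]
  rw [hb] at hder
  have hb' : (∀ S, b S = 0) ∨
      ∀ z : σ → ℂ, (∀ i, 0 < (z i).im) → (∑ S : Finset σ, (b S : ℂ) * ∏ i ∈ S, z i) ≠ 0 := by
    rcases hder with h | h
    · left
      intro S
      have := (multiAffine_eq_zero_iff _).1 h S
      exact_mod_cast this
    · right
      exact (isUpperHalfPlaneStable_multiAffine_iff _).1 h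
  have key := multiAffine_twoByTwo_nlc b hxy hb'
  -- read off the four coefficients
  have h1 : b ∅ = a T := by simp [b]
  have h2 : b {x} = a (insert x T) := by
    have hd : Disjoint T {x} := Finset.disjoint_singleton_right.2 hx
    simp only [b, if_pos hd]
    rw [Finset.insert_eq, Finset.union_comm]
  have h3 : b {y} = a (insert y T) := by
    have hd : Disjoint T {y} := Finset.disjoint_singleton_right.2 hy
    simp only [b, if_pos hd]
    rw [Finset.insert_eq, Finset.union_comm]
  have h4 : b {x, y} = a (insert x (insert y T)) := by
    have hd : Disjoint T {x, y} := by simp [hx, hy]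
    simp only [b, if_pos hd]
    congr 1
    ext j
    simp only [Finset.mem_union, Finset.mem_insert, Finset.mem_singleton]
    tauto
  rw [h1, h2, h3, h4] at key
  exact key

end Literature.Combinatorics.StablePolynomials

end
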